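import Literature.Geometry.Lorentzian.CoordScalarCurvatureEvolution
import HarnessLib

/-!
# The first variation of the scalar curvature in the direction of the Ricci tensor, in coordinates

`CoordScalarCurvatureEvolution.lean` proves Topping's Prop. 2.5.4 in coordinates
(`∂_t S = ΔS + 2|Ric|²` for a family of metric components with `∂G/∂t = −2 Ric(G)` on the whole
time set). The Ricci variation of Schoen–Yau, Comm. Math. Phys. 65 (1979), §3 (3.24)–(3.25)
(*"A known formula gives `R'₀ = -Δ(tr Ric) + δδ Ric - ‖Ric‖²` … Since `R ≡ 0` … a direct
application of the second Bianchi identity shows `δδ Ric = ½ ΔR = 0`. Thus `R'₀ = -‖Ric‖²`"*)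
needs the same computation for the family `ds² + t Ric`, i.e. with `h = +Ric` **at the single
time `t = 0`**. This file redoes the computation of that file with a general constant `c` and
the relation `h = c Ric(G t)` assumed at one time `t` only (all results proved; the proofs are
those of `CoordScalarCurvatureEvolution.lean`, §"The Ricci flow in coordinates", with the
constant threaded through):

* `IsMetricFamilyOn.apply_varChrAt_of_tDeriv_eq` — Prop. 2.3.1 for `h = c Ric`;
* `sum_ginv_smul_varChrAt_eq_zero_of_tDeriv_eq` — `tr_G Π = 0` (contracted Bianchi identity);
* `sum_coord_varChrAt_eq_of_tDeriv_eq` — `tr Π(·, Z) = (c/2) dS(Z)`;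
* `termA_eq_zero_of_tDeriv_eq`, `termB_eq_of_tDeriv_eq`, `sum_dginv_ricAt_eq_of_tDeriv_eq` —
  the three traces: `0`, `(c/2) ΔS`, `−c|Ric|²`;
* `hasDerivWithinAt_scalAt_of_tDeriv_eq` — **`∂_t S = −c |Ric|² − (c/2) ΔS` at `t`**.

## References

* P. Topping, *Lectures on the Ricci flow*, LMS Lecture Note Series 325, CUP 2006, Prop. 2.3.1,
  2.3.6, 2.3.9 and (2.3.14)–(2.3.17). [Topping2006]
* R. Schoen, S.-T. Yau, *On the proof of the positive mass conjecture in general relativity*,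
  Comm. Math. Phys. 65 (1979) 45–76, §3 (3.24)–(3.25). [SchoenYauPMT1979]
* J. Kazdan, F. Warner, *Prescribing curvatures*, Proc. Sympos. Pure Math. 27 (1975) ([20] of
  Schoen–Yau: the first variation of the scalar curvature).
-/

noncomputable section

set_option maxSynthPendingDepth 3

open Set Filter ContinuousLinearMap Module
open scoped Topology ContDiff

namespace Literature.Geometry.Lorentzian

namespace MetricCoord

namespace IsMetricFamilyOn

variable {E : Type*} [NormedAddCommGroup E] [NormedSpace ℝ E]
  {ι : Type*} [Fintype ι] [FiniteDimensional ℝ E] [CompleteSpace E]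
  {G : ℝ → E → E →L[ℝ] E →L[ℝ] ℝ} {S : Set ℝ} {V : Set E} {x : E} {t : ℝ} (b : Basis ι ℝ E)

section TDerivRicci

variable (hG : IsMetricFamilyOn G S V) {c : ℝ}
  (hfl : ∀ y ∈ V, tDeriv G S t y = c • ricAt (G t) y)
include hG hfl

omit [Fintype ι] in
/-- If `h = c Ric` on `V` at time `t`, then `∇h = c ∇Ric` on `V`. [cite: Topping2006, Prop. 2.3.1] -/
theorem cov₂At_tDeriv_of_tDeriv_eq (ht : t ∈ S) {y : E} (hy : y ∈ V) :
    cov₂At (G t) (tDeriv G S t) y = c • cov₂At (G t) (ricAt (G t)) y := by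
  have heq : tDeriv G S t =ᶠ[𝓝 y] fun z ↦ c • ricAt (G t) z :=
    ((hG.isOpen ht).mem_nhds hy |> fun h ↦ Filter.eventually_of_mem h fun z hz ↦ hfl z hz)
  rw [cov₂At_congr heq, cov₂At_const_smul ((hG.isMetricOn t ht).differentiableAt_ricAt hy)]

omit [Fintype ι] in
/-- **Prop. 2.3.1 for `h = c Ric`**:
`G(Π(X,Y), Z) = (c/2)[(∇_X Ric)(Y,Z) + (∇_Y Ric)(X,Z) − (∇_Z Ric)(X,Y)]`.
[cite: Topping2006, Prop. 2.3.1] -/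
theorem apply_varChrAt_of_tDeriv_eq (ht : t ∈ S) {y : E} (hy : y ∈ V) (X Y Z : E) :
    G t y (varChrAt G S t y X Y) Z =
      c / 2 * (cov₂At (G t) (ricAt (G t)) y X Y Z + cov₂At (G t) (ricAt (G t)) y Y X Z
        - cov₂At (G t) (ricAt (G t)) y Z X Y) := by
  rw [hG.apply_varChrAt hy ht, hG.cov₂At_tDeriv_of_tDeriv_eq hfl ht hy]
  simp only [_root_.smul_apply, smul_eq_mul]
  ring

/-- **The trace of `Π` vanishes for `h = c Ric`** (contracted Bianchi identity):
`Σ_{kl} g^{kl} Π(b_k, b_l) = 0` on `V`, since `G(Σ g^{kl}Π(b_k,b_l), Z) = (c/2)(2 div Ric(Z) − dS(Z)) = 0`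
(Topping 2006, proof of Prop. 2.3.9: the term `δ²h` with `δ Ric = −½ dR`).
[cite: Topping2006, Prop. 2.3.9] -/
theorem sum_ginv_smul_varChrAt_eq_zero_of_tDeriv_eq (ht : t ∈ S) {y : E} (hy : y ∈ V) :
    ∑ k, ∑ l, ginv (G t) b y k l • varChrAt G S t y (b k) (b l) = 0 := by
  have hGt := hG.isMetricOn t ht
  have hi := hGt.isInvertible y hy
  -- pair with an arbitrary `Z`
  have hpair : ∀ Z, G t y (∑ k, ∑ l, ginv (G t) b y k l • varChrAt G S t y (b k) (b l)) Z = 0 := by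
    intro Z
    simp only [map_sum, map_smul, FunLike.coe_sum, Finset.sum_apply, _root_.smul_apply, smul_eq_mul,
      hG.apply_varChrAt_of_tDeriv_eq hfl ht hy]
    -- the three contractions of `∇Ric`
    have h1 : fderiv ℝ (scalAt (G t)) y Z =
        2 * ∑ k, ∑ l, ginv (G t) b y k l * cov₂At (G t) (ricAt (G t)) y (b k) (b l) Z :=
      hGt.fderiv_scalAt' b hy Z
    have h2 : ∑ k, ∑ l, ginv (G t) b y k l * cov₂At (G t) (ricAt (G t)) y (b l) (b k) Z =
        ∑ k, ∑ l, ginv (G t) b y k l * cov₂At (G t) (ricAt (G t)) y (b k) (b l) Z := by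
      rw [Finset.sum_comm]
      refine Finset.sum_congr rfl fun k _ ↦ Finset.sum_congr rfl fun l _ ↦ ?_
      rw [ginv_comm b hi (hGt.symm y hy) l k]
    have h3 : ∑ k, ∑ l, ginv (G t) b y k l * cov₂At (G t) (ricAt (G t)) y Z (b k) (b l) =
        fderiv ℝ (scalAt (G t)) y Z := by
      rw [hGt.fderiv_scalAt_eq_mtrAt hy Z, mtrAt_eq_sum b]
    have hsplit : ∑ k, ∑ l, ginv (G t) b y k l *
        (c / 2 * (cov₂At (G t) (ricAt (G t)) y (b k) (b l) Z + cov₂At (G t) (ricAt (G t)) y (b l) (b k) Z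
          - cov₂At (G t) (ricAt (G t)) y Z (b k) (b l))) =
        c / 2 * (∑ k, ∑ l, ginv (G t) b y k l * cov₂At (G t) (ricAt (G t)) y (b k) (b l) Z)
        + c / 2 * (∑ k, ∑ l, ginv (G t) b y k l * cov₂At (G t) (ricAt (G t)) y (b l) (b k) Z)
        - c / 2 * ∑ k, ∑ l, ginv (G t) b y k l * cov₂At (G t) (ricAt (G t)) y Z (b k) (b l) := by
      simp only [Finset.mul_sum, ← Finset.sum_add_distrib, ← Finset.sum_sub_distrib]
      refine Finset.sum_congr rfl fun k _ ↦ Finset.sum_congr rfl fun l _ ↦ ?_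
      ring
    rw [hsplit, h2, h3, h1]
    ring
  -- nondegeneracy
  have h0 : G t y (∑ k, ∑ l, ginv (G t) b y k l • varChrAt G S t y (b k) (b l)) = 0 := by
    ext Z; exact hpair Z
  rw [← sharpAt_apply hi (∑ k, ∑ l, ginv (G t) b y k l • varChrAt G S t y (b k) (b l)), h0, map_zero]

/-- **`tr_X Π(X, Z) = (c/2) dS(Z)` for `h = c Ric`**: `Σᵢ bⁱ(Π(bᵢ, Z)) = (c/2) ∂_Z S` on `V`
(Topping 2006, proof of Prop. 2.3.9: `tr Π(·,Z) = ½ d(tr h)(Z)` with `tr h = c S`).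
[cite: Topping2006, Prop. 2.3.9] -/
theorem sum_coord_varChrAt_eq_of_tDeriv_eq (ht : t ∈ S) {y : E} (hy : y ∈ V) (Z : E) :
    ∑ i, b.coord i (varChrAt G S t y (b i) Z) = c / 2 * fderiv ℝ (scalAt (G t)) y Z := by
  have hGt := hG.isMetricOn t ht
  have hi := hGt.isInvertible y hy
  have hRs : ∀ᶠ z in 𝓝 y, ∀ v w, ricAt (G t) z v w = ricAt (G t) z w v :=
    ((hG.isOpen ht).mem_nhds hy |> fun h ↦ Filter.eventually_of_mem h fun z hz ↦ hGt.ricAt_comm hz)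
  have hsym : ∀ W Y Z', cov₂At (G t) (ricAt (G t)) y W Y Z' = cov₂At (G t) (ricAt (G t)) y W Z' Y :=
    cov₂At_symm (hGt.differentiableAt_ricAt hy) hRs
  -- expand `bⁱ(Π(bᵢ,Z)) = Σⱼ g^{ij} G(Π(bᵢ,Z), bⱼ)`
  have hexp : ∑ i, b.coord i (varChrAt G S t y (b i) Z) =
      c / 2 * (∑ i, ∑ j, ginv (G t) b y i j * cov₂At (G t) (ricAt (G t)) y (b i) Z (b j))
      + c / 2 * (∑ i, ∑ j, ginv (G t) b y i j * cov₂At (G t) (ricAt (G t)) y Z (b i) (b j))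
      - c / 2 * ∑ i, ∑ j, ginv (G t) b y i j * cov₂At (G t) (ricAt (G t)) y (b j) (b i) Z := by
    simp only [coord_eq_sum_ginv b hi, hG.apply_varChrAt_of_tDeriv_eq hfl ht hy, Finset.mul_sum,
      ← Finset.sum_add_distrib, ← Finset.sum_sub_distrib]
    refine Finset.sum_congr rfl fun i _ ↦ Finset.sum_congr rfl fun j _ ↦ ?_
    ring
  have h13 : ∑ i, ∑ j, ginv (G t) b y i j * cov₂At (G t) (ricAt (G t)) y (b j) (b i) Z =
      ∑ i, ∑ j, ginv (G t) b y i j * cov₂At (G t) (ricAt (G t)) y (b i) Z (b j) := by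
    rw [Finset.sum_comm]
    refine Finset.sum_congr rfl fun i _ ↦ Finset.sum_congr rfl fun j _ ↦ ?_
    rw [ginv_comm b hi (hGt.symm y hy) j i, hsym (b i) Z (b j)]
  have h2 : ∑ i, ∑ j, ginv (G t) b y i j * cov₂At (G t) (ricAt (G t)) y Z (b i) (b j) =
      fderiv ℝ (scalAt (G t)) y Z := by
    rw [hGt.fderiv_scalAt_eq_mtrAt hy Z, mtrAt_eq_sum b]
  rw [hexp, h13, h2]
  ring

/-- **The `div`-term vanishes for `h = c Ric`**: for every functional `φ` and direction `X`,
`Σ_{kl} g^{kl} [φ(D_XΠ(b_k,b_l)) − φ(Π(Γ(X,b_k),b_l)) − φ(Π(b_k,Γ(X,b_l)))] = 0`, i.e.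
`φ((∇_X tr_G Π)) − φ(Γ_X tr_G Π) = ∂_X φ(tr_G Π) = 0` (metric traces commute with `∇`, and
`tr_G Π = 0` identically on `V`). [cite: Topping2006, Prop. 2.3.9] -/
theorem sum_ginv_fderiv_varChrAt_eq_zero_of_tDeriv_eq (hx : x ∈ V) (ht : t ∈ S) (φ : E →L[ℝ] ℝ) (X : E) :
    ∑ k, ∑ l, ginv (G t) b x k l * (φ (fderiv ℝ (varChrAt G S t) x X (b k) (b l))
      - φ (varChrAt G S t x (chrAt (G t) x X (b k)) (b l))
      - φ (varChrAt G S t x (b k) (chrAt (G t) x X (b l)))) = 0 := by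
  have hGt := hG.isMetricOn t ht
  have hPd := hG.differentiableAt_varChrAt hx ht
  -- the scalar field of bilinear forms `β_φ = φ ∘ Π`
  set β : E → E →L[ℝ] E →L[ℝ] ℝ := fun y ↦
    (ContinuousLinearMap.compL ℝ E E ℝ φ).comp (varChrAt G S t y) with hβ
  have hβapp : ∀ y Y Z, β y Y Z = φ (varChrAt G S t y Y Z) := fun y Y Z ↦ rfl
  have hβd : HasFDerivAt β ((ContinuousLinearMap.compL ℝ E (E →L[ℝ] E) (E →L[ℝ] ℝ)
      (ContinuousLinearMap.compL ℝ E E ℝ φ)).comp (fderiv ℝ (varChrAt G S t) x)) x :=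
    (ContinuousLinearMap.compL ℝ E (E →L[ℝ] E) (E →L[ℝ] ℝ)
      (ContinuousLinearMap.compL ℝ E E ℝ φ)).hasFDerivAt.comp x hPd.hasFDerivAt
  have hDβ : ∀ Y Z, fderiv ℝ β x X Y Z = φ (fderiv ℝ (varChrAt G S t) x X Y Z) := by
    intro Y Z; rw [hβd.fderiv]; rfl
  -- its metric trace is `φ (tr_G Π) = 0` near `x`
  have htr0 : (fun y ↦ mtrAt (G t) y (β y)) =ᶠ[𝓝 x] fun _ ↦ (0 : ℝ) := by
    filter_upwards [(hG.isOpen ht).mem_nhds hx] with y hy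
    rw [mtrAt_eq_sum b]
    have h0 := congrArg φ (hG.sum_ginv_smul_varChrAt_eq_zero_of_tDeriv_eq b hfl ht hy)
    rw [map_zero, map_sum] at h0
    rw [← h0]
    refine Finset.sum_congr rfl fun k _ ↦ ?_
    rw [map_sum]
    refine Finset.sum_congr rfl fun l _ ↦ ?_
    rw [map_smul, smul_eq_mul, hβapp]
  have hD0 : fderiv ℝ (fun y ↦ mtrAt (G t) y (β y)) x X = 0 := by
    rw [htr0.fderiv_eq, fderiv_fun_const]; rfl
  rw [hGt.fderiv_mtrAt hx hβd.differentiableAt X, mtrAt_eq_sum b] at hD0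
  simp only [cov₂At_apply, hDβ, hβapp] at hD0
  exact hD0

/-- **The first (`div`) trace of `∂_t Ric` vanishes for `h = c Ric`**:
`Σ_{kl} g^{kl} Σᵢ bⁱ((∇_{bᵢ}Π)(b_k) b_l) = 0`. [cite: Topping2006, Prop. 2.3.9] -/
theorem termA_eq_zero_of_tDeriv_eq (hx : x ∈ V) (ht : t ∈ S) :
    ∑ k, ∑ l, ginv (G t) b x k l * ∑ i, b.coord i
      (fderiv ℝ (varChrAt G S t) x (b i) (b k) (b l)
        + chrAt (G t) x (b i) (varChrAt G S t x (b k) (b l))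
        - varChrAt G S t x (chrAt (G t) x (b i) (b k)) (b l)
        - varChrAt G S t x (b k) (chrAt (G t) x (b i) (b l))) = 0 := by
  have hV0 := hG.sum_ginv_smul_varChrAt_eq_zero_of_tDeriv_eq b hfl ht hx
  have hstar := fun i ↦ hG.sum_ginv_fderiv_varChrAt_eq_zero_of_tDeriv_eq b hfl hx ht (coordCLM b i) (b i)
  simp only [coordCLM_apply] at hstar
  -- the `Γ` term: `Σ_{kl} g^{kl} bⁱ(Γᵢ Π(b_k,b_l)) = bⁱ(Γᵢ (tr_G Π)) = 0`
  have hΓ : ∀ i, ∑ k, ∑ l, ginv (G t) b x k l *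
      b.coord i (chrAt (G t) x (b i) (varChrAt G S t x (b k) (b l))) = 0 := by
    intro i
    have h := congrArg (fun v ↦ b.coord i (chrAt (G t) x (b i) v)) hV0
    simp only [map_sum, map_smul, map_zero, smul_eq_mul] at h
    exact h
  -- reorganise the sums
  calc ∑ k, ∑ l, ginv (G t) b x k l * ∑ i, b.coord i
        (fderiv ℝ (varChrAt G S t) x (b i) (b k) (b l)
          + chrAt (G t) x (b i) (varChrAt G S t x (b k) (b l))
          - varChrAt G S t x (chrAt (G t) x (b i) (b k)) (b l)
          - varChrAt G S t x (b k) (chrAt (G t) x (b i) (b l)))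
      = ∑ i, (∑ k, ∑ l, ginv (G t) b x k l * (b.coord i (fderiv ℝ (varChrAt G S t) x (b i) (b k) (b l))
          - b.coord i (varChrAt G S t x (chrAt (G t) x (b i) (b k)) (b l))
          - b.coord i (varChrAt G S t x (b k) (chrAt (G t) x (b i) (b l))))
        + ∑ k, ∑ l, ginv (G t) b x k l *
            b.coord i (chrAt (G t) x (b i) (varChrAt G S t x (b k) (b l)))) := by
        simp only [map_add, map_sub, Finset.mul_sum, mul_add, mul_sub]
        rw [sum_comm₃]
        refine Finset.sum_congr rfl fun i _ ↦ ?_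
        rw [← Finset.sum_add_distrib]
        refine Finset.sum_congr rfl fun k _ ↦ ?_
        rw [← Finset.sum_add_distrib]
        refine Finset.sum_congr rfl fun l _ ↦ ?_
        ring
    _ = 0 := by simp only [hstar, hΓ, add_zero, Finset.sum_const_zero]

/-- **The second trace of `∂_t Ric` is `(c/2) ΔS` for `h = c Ric`**:
`Σ_{kl} g^{kl} Σᵢ bⁱ((∇_{b_k}Π)(bᵢ) b_l) = (c/2) ΔS` (`tr Π(·,Z) = (c/2) dS(Z)`, so the trace is
`tr_G ∇((c/2) dS) = (c/2) tr_G Hess S`; Topping 2006, (2.3.16)). [cite: Topping2006, Prop. 2.3.9] -/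
theorem termB_eq_of_tDeriv_eq (hx : x ∈ V) (ht : t ∈ S) :
    ∑ k, ∑ l, ginv (G t) b x k l * ∑ i, b.coord i
      (fderiv ℝ (varChrAt G S t) x (b k) (b i) (b l)
        + chrAt (G t) x (b k) (varChrAt G S t x (b i) (b l))
        - varChrAt G S t x (chrAt (G t) x (b k) (b i)) (b l)
        - varChrAt G S t x (b i) (chrAt (G t) x (b k) (b l))) =
      c / 2 * lapAt (G t) (scalAt (G t)) x := by
  have hGt := hG.isMetricOn t ht
  have hPd := hG.differentiableAt_varChrAt hx ht
  have hSc : ContDiffAt ℝ ∞ (scalAt (G t)) x := hGt.contDiffAt_scalAt hx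
  have hdS : DifferentiableAt ℝ (fderiv ℝ (scalAt (G t))) x :=
    (hSc.fderiv_right (m := ∞) (by simp)).differentiableAt (by simp)
  -- `ω(y)(Z) = Σᵢ bⁱ(Π_y(bᵢ, Z)) = −dS_y(Z)` near `x`
  have hω : ∀ Z, (fun y ↦ ∑ i, b.coord i (varChrAt G S t y (b i) Z)) =ᶠ[𝓝 x]
      fun y ↦ c / 2 * fderiv ℝ (scalAt (G t)) y Z := fun Z ↦ by
    filter_upwards [(hG.isOpen ht).mem_nhds hx] with y hy
    exact hG.sum_coord_varChrAt_eq_of_tDeriv_eq b hfl ht hy Z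
  -- (1) the `DΠ` term: `Σᵢ bⁱ(D_{b_k}Π(bᵢ,b_l)) = ∂_{b_k} ω(·)(b_l) = −D²S(b_k, b_l)`
  have h1 : ∀ k l, ∑ i, b.coord i (fderiv ℝ (varChrAt G S t) x (b k) (b i) (b l)) =
      c / 2 * fderiv ℝ (fderiv ℝ (scalAt (G t))) x (b k) (b l) := by
    intro k l
    have hdiff : ∀ i, DifferentiableAt ℝ (fun y ↦ varChrAt G S t y (b i) (b l)) x := fun i ↦
      differentiableAt_clm_apply_const (differentiableAt_clm_apply_const hPd (b i)) (b l)
    have hsum : fderiv ℝ (fun y ↦ ∑ i, b.coord i (varChrAt G S t y (b i) (b l))) x (b k) =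
        ∑ i, b.coord i (fderiv ℝ (varChrAt G S t) x (b k) (b i) (b l)) := by
      have hs : HasFDerivAt (fun y ↦ ∑ i, coordCLM b i (varChrAt G S t y (b i) (b l)))
          (∑ i, (coordCLM b i).comp (fderiv ℝ (fun y ↦ varChrAt G S t y (b i) (b l)) x)) x :=
        HasFDerivAt.fun_sum fun i _ ↦ (coordCLM b i).hasFDerivAt.comp x (hdiff i).hasFDerivAt
      simp only [coordCLM_apply] at hs
      rw [hs.fderiv, FunLike.coe_sum, Finset.sum_apply]
      refine Finset.sum_congr rfl fun i _ ↦ ?_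
      rw [ContinuousLinearMap.comp_apply, coordCLM_apply,
        fderiv_clm_apply_const (differentiableAt_clm_apply_const hPd (b i)) (b l) (b k),
        fderiv_clm_apply_const hPd (b i) (b k)]
    rw [← hsum, (hω (b l)).fderiv_eq,
      fderiv_const_mul (differentiableAt_clm_apply_const hdS (b l)) (c / 2),
      _root_.smul_apply, smul_eq_mul, fderiv_clm_apply_const hdS (b l) (b k)]
  -- (2) the `Γ ∘ Π` and `Π ∘ Γ` terms cancel (trace of a commutator)
  have h2 : ∀ k l, ∑ i, b.coord i (chrAt (G t) x (b k) (varChrAt G S t x (b i) (b l))) =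
      ∑ i, b.coord i (varChrAt G S t x (chrAt (G t) x (b k) (b i)) (b l)) := fun k l ↦
    sum_coord_comp_comm b (chrAt (G t) x (b k)) ((varChrAt G S t x).flip (b l))
  -- (3) the last term: `Σᵢ bⁱ(Π(bᵢ, Γ(b_k,b_l))) = −dS(Γ(b_k,b_l))`
  have h3 : ∀ k l, ∑ i, b.coord i (varChrAt G S t x (b i) (chrAt (G t) x (b k) (b l))) =
      c / 2 * fderiv ℝ (scalAt (G t)) x (chrAt (G t) x (b k) (b l)) := fun k l ↦
    hG.sum_coord_varChrAt_eq_of_tDeriv_eq b hfl ht hx _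
  rw [lapAt_eq_sum (G t) b, Finset.mul_sum]
  refine Finset.sum_congr rfl fun k _ ↦ ?_
  rw [Finset.mul_sum]
  refine Finset.sum_congr rfl fun l _ ↦ ?_
  simp only [map_add, map_sub, Finset.sum_add_distrib, Finset.sum_sub_distrib, h1, h2, h3]
  ring

/-- **The `−⟨h, Ric⟩` term is `−c |Ric|²` for `h = c Ric`**:
`Σ_{kl} (∂_t g^{kl}) Ric_{kl} = −c tr((♯Ric)²) = −c |Ric|²`. [cite: Topping2006, Prop. 2.3.6] -/
theorem sum_dginv_ricAt_eq_of_tDeriv_eq (hx : x ∈ V) (ht : t ∈ S) :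
    ∑ k, ∑ l, b.coord k (-(sharpAt (G t) x (tDeriv G S t x (sharpAt (G t) x (coordCLM b l)))))
      * ricAt (G t) x (b k) (b l) = -c * normSqAt (G t) x (ricAt (G t) x) := by
  have hGt := hG.isMetricOn t ht
  set Sh := sharpAt (G t) x with hSh
  set R := ricAt (G t) x with hR
  have hflip : R.flip = R := by
    ext v w; exact hGt.ricAt_comm hx w v
  rw [hfl x hx, normSqAt_eq_traceCLM, traceCLM_apply, trace_eq_sum_coord b, hflip, Finset.mul_sum]
  refine Finset.sum_congr rfl fun k _ ↦ ?_
  -- `Σ_l bᵏ(−c ♯R♯ bˡ) R(b_k,b_l) = bᵏ(−c ♯R♯ (R b_k))`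
  have hRk : R (b k) = ∑ l, R (b k) (b l) • coordCLM b l := eq_sum_smul_coordCLM b (R (b k))
  rw [← hR, ← hSh]
  simp only [_root_.smul_apply, map_smul, map_neg, smul_eq_mul, ContinuousLinearMap.coe_coe,
    ContinuousLinearMap.comp_apply]
  conv_rhs => rw [hRk]
  simp only [map_sum, map_smul, smul_eq_mul, Finset.mul_sum]
  refine Finset.sum_congr rfl fun l _ ↦ ?_
  ring

/-- **The first variation of the scalar curvature in the direction `c Ric`** (Topping 2006,
Prop. 2.3.9: `∂_t R = −⟨Ric, h⟩ + δ²h − Δ tr h`, with `δ Ric = −½ dR`; in coordinates). Let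
`G` be a smooth one-parameter family of metric components on `V × S` (`IsMetricFamilyOn`) whose
time derivative at the time `t ∈ S` is `h = c Ric(G t)` on `V`. Then at every `x ∈ V` the
scalar curvature `s ↦ S(G s)(x)` is differentiable within `S` at `t` with derivative
`−c |Ric|² − (c/2) ΔS` (`normSqAt`, `lapAt` of `G t` at `x`). For `c = −2` and a family
satisfying the relation at all times this is Prop. 2.5.4, `∂R/∂t = ΔR + 2|Ric|²`
(`hasDerivWithinAt_scalAt_ricciFlow`); for `c = 1` at `t = 0` and `S(G 0) ≡ 0` it is the step
`R'₀ = −‖Ric‖²` of Schoen–Yau 1979, (3.24)–(3.25). [cite: Topping2006, Prop. 2.3.9] -/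
theorem hasDerivWithinAt_scalAt_of_tDeriv_eq (hx : x ∈ V) (ht : t ∈ S) :
    HasDerivWithinAt (fun s ↦ scalAt (G s) x)
      (-c * normSqAt (G t) x (ricAt (G t) x) - c / 2 * lapAt (G t) (scalAt (G t)) x) S t := by
  have hGt := hG.isMetricOn t ht
  set b := Module.finBasis ℝ E
  have hd := hG.hasDerivWithinAt_scalAt b hx ht
  refine hd.congr_deriv ?_
  rw [Finset.sum_congr rfl fun k _ ↦ Finset.sum_add_distrib, Finset.sum_add_distrib,
    hG.sum_dginv_ricAt_eq_of_tDeriv_eq b hfl hx ht]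
  -- the `tr_G ∂_t Ric` term: expand `varRiemAt` into the two traces
  have hA := hG.termA_eq_zero_of_tDeriv_eq b hfl hx ht
  have hB := hG.termB_eq_of_tDeriv_eq b hfl hx ht
  have hc := hGt.chrAt_comm hx
  have hsplit : ∑ k, ∑ l, ginv (G t) b x k l * ∑ i, b.coord i (varRiemAt G S t x (b i) (b k) (b l)) =
      (∑ k, ∑ l, ginv (G t) b x k l * ∑ i, b.coord i
        (fderiv ℝ (varChrAt G S t) x (b i) (b k) (b l)
          + chrAt (G t) x (b i) (varChrAt G S t x (b k) (b l))
          - varChrAt G S t x (chrAt (G t) x (b i) (b k)) (b l)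
          - varChrAt G S t x (b k) (chrAt (G t) x (b i) (b l))))
      - ∑ k, ∑ l, ginv (G t) b x k l * ∑ i, b.coord i
        (fderiv ℝ (varChrAt G S t) x (b k) (b i) (b l)
          + chrAt (G t) x (b k) (varChrAt G S t x (b i) (b l))
          - varChrAt G S t x (chrAt (G t) x (b k) (b i)) (b l)
          - varChrAt G S t x (b i) (chrAt (G t) x (b k) (b l))) := by
    rw [← Finset.sum_sub_distrib]
    refine Finset.sum_congr rfl fun k _ ↦ ?_
    rw [← Finset.sum_sub_distrib]
    refine Finset.sum_congr rfl fun l _ ↦ ?_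
    rw [← mul_sub, ← Finset.sum_sub_distrib]
    congr 1
    refine Finset.sum_congr rfl fun i _ ↦ ?_
    rw [← map_sub]
    congr 1
    simp only [varRiemAt_apply, hc (b k) (b i)]
    abel
  rw [hsplit, hA, hB]
  ring


end TDerivRicci

end IsMetricFamilyOn

end MetricCoord

end Literature.Geometry.Lorentzian

end
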